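import Summits.QuantumFields.BalabanUV.Beta.CapRouteABoxes
import Summits.QuantumFields.BalabanUV.Beta.TableCovariance

/-!
# Beta / CapRouteABoxesReflect — THE (W) INPUT AT FOUR SLICES for a reflection-invariant determinant, det-invariance from four G6
# conjugations, the anchor in certificate currency with 8 closed compass words, and the honest (lossy) transport of a resolvent bound under a
# `q`-dependent conjugation (β sub-cell, BINDER-OWNERS row CAP-k, lineage `b2b-balaban-beta-an5`, gen 24; node BETA-an5-g24-REFLECT-BLOCK,
# leaf 1; journal CLAIM l.15743)

WHY.  cap5-g7 (journal l.15580): engine E's bordered one-loop kernel `k₀` satisfies the LITERAL entry form `hK` of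
`TableCovariance.matCovariantQ_characterSum_relabel` for EVERY direction `ν ∈ {0,1,2,3}`, hence `det k₀ ∘ reflectAt ν = det k₀` for all four `ν`
(`VertexToriSymmetryCovariantQ.matCovariantQ_det_eq`), so THEOREM DB's (W) input (`TubeZeroFree`: one `SliceWindingEq` per coordinate × sign
pattern, 4 × 8 = 32 slices; 6 after `TubeZeroFreeSymmetry`) reduces to the FOUR ALL-PLUS reference slices (`TubeHol.ne_zero_of_vertexTori_of_reflect`).
This file packages that reduction in the exact hypothesis shape gen 23's anchor consumes.

* §1 `windingHyp_of_reflect`: `G ∘ reflectAt ν = G ∀ν` + `SliceWindingEq G w i (all-plus point) ∀i` ⟹ the pattern-indexed (W) hypothesis of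
  `TubeHol.ne_zero_of_vertexTori` ∕ `MatTubeHol.det_ne_zero_of_vertexTori` (the induction of `…_of_reflect`, exported as data).
* §2 `det_reflectAt_of_matCovariantQ` (four `MatCovariantQ (reflectAt ν) (U ν) (V ν) A` with `V ν q · U ν q = 1` ⟹ det-invariance) and
  `det_reflectAt_of_relabel` (the same from four G6 ENTRY FORMS of a character-sum stencil family — cap5's literal statement).
* §3 **`rowsOfOneLoopFormCode16E_routeA₂_ofBoxesRealShift_ofReflect`** = gen 23's `CapRouteABoxes.rowsOfOneLoopFormCode16E_routeA₂_ofBoxesRealShift`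
  with its (W) binder REPLACED by `hR` (det-invariance under the four reflections) + `hW4` (FOUR slices; each = two closed compass words via
  `TubeZeroFreeEnds.sliceWindingEq_of_words` ⟹ 8 words in all).
* §4 `invNorm_apply_le_of_matCovariantQ`: `‖A(τ q)⁻¹‖ ≤ ‖U q‖·‖A(q)⁻¹‖·‖V q‖` and the single-reflection region lemma
  `invNorm_le_vertexTori_of_plusHalf` (a bound `B` on `{Im q_ν = +w_ν}` gives `L·B` on all vertex tori when `‖U q‖‖V q‖ ≤ L`, `1 ≤ L`).  HONEST
  LIMIT (answers cap1-g10 l.15269 (5) «2 face classes IF a kernel covariance statement for the norm bound is made»): for the G6 conjugators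
  `P_ν(q)[π i, i] = s_i e^{i q_ν dl_i}` on `|Im q_ν| = κ` the loss is `‖P_ν‖‖P_ν⁻¹‖ = e^{κ·(max dl − min dl)}` per reflection used (= e^{0.9}
  for the cell's tables, e^{1.8} ≈ 6.05 for the two-reflection reduction to 2 classes) — the transport of the RESOLVENT NORM is lossy, unlike
  that of `det` ((Z1)) which is exact; the certified region of the row stays the quarter region `{Im q_{ν₀} = +κ, Re q_{ν₁} ≤ 0}` of gen 22–23.

HONEST FRAMING.  Kernel glue ([folklore] linear algebra ∕ bookkeeping): which symmetries the cell's tables have is a HYPOTHESIS here (evidence: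
cap5-g7 `entryform4.json` 2982a36fafa5b270, cap4-g15 polecheck (5) — outside the kernel until typed tables exist); no box, no word, no number
supplied; 0 binders instantiated.  Discharging `BetaPertH` would make Bałaban's UV stability unconditional — NOT the continuum limit, NOT Clay.
0 `sorry`, 0 cite tags.
-/

namespace Summit.QuantumFields.BalabanUV.Beta.CapRouteABoxesReflect

open Complex Set Matrix
open Literature.MathematicalPhysics.QuantumFieldTheory.Balaban1983to89
open B4Strip (Strip)
open B4ContourShift (latticeKernel)
open B4TorusKernel (descend gridPt)
open Beta.AliasingTailL1 (aliasRatioL1)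
open Beta.AliasingTailLattice (codeTheta code16SetE)
open Summit.QuantumFields.BalabanUV.Beta.CapRows (Rows)
open Summit.QuantumFields.BalabanUV.Beta.TubeMaximumModulus
open Summit.QuantumFields.BalabanUV.Beta.VertexToriSymmetry
open Summit.QuantumFields.BalabanUV.Beta.ConjReflectionAlgebra (MatConjSymm)
open Summit.QuantumFields.BalabanUV.Beta.ResolventBoxCertificate (Box)
open Summit.QuantumFields.BalabanUV.Beta.TableCovariance (relabelConj relabelConjInv relabelConjInv_mul shiftRefl
  matCovariantQ_characterSum_relabel)
open Summit.QuantumFields.BalabanUV.Beta.PolyRegularAlgebra (character)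
open Summit.QuantumFields.BalabanUV.Beta.CapRouteABoxes (rowsOfOneLoopFormCode16E_routeA₂_ofBoxesRealShift)
open scoped Real Matrix.Norms.L2Operator

noncomputable section

variable {d : ℕ}

/-! ## §1 (W) at the d + 1 all-plus slices + reflection invariance ⟹ the pattern-indexed (W) hypothesis -/

section Winding

variable {G : (Fin (d + 1) → ℂ) → ℂ} {w : Fin (d + 1) → ℝ}

/-- **(W) FROM THE ALL-PLUS SLICES**: if `G (reflectAt ν p) = G p` for every coordinate `ν`, then `SliceWindingEq` at the d + 1 all-plus reference
points `j ↦ i·w_{succAbove i j}` yields, for every coordinate `i` and sign pattern `s ∈ {±1}^d`, a parameter with `Im = s_j w_j` carrying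
`SliceWindingEq` — literally the (W) hypothesis of `TubeHol.ne_zero_of_vertexTori` ∕ `MatTubeHol.det_ne_zero_of_vertexTori`. [folklore] -/
theorem windingHyp_of_reflect (hR : ∀ ν p, G (reflectAt ν p) = G p)
    (hW : ∀ i : Fin (d + 1), SliceWindingEq G w i fun j => ((w (i.succAbove j) : ℝ) : ℂ) * I) :
    ∀ (i : Fin (d + 1)) (s : Fin d → ℝ), (∀ j, s j = 1 ∨ s j = -1) →
      ∃ q₀ : Fin d → ℂ, (∀ j, (q₀ j).im = s j * w (i.succAbove j)) ∧ SliceWindingEq G w i q₀ := by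
  classical
  intro i s hs
  -- the reference point of the class `s`, reached from the all-plus point by the reflections `j ∈ J := {j | s j = −1}`
  let qJ : Finset (Fin d) → Fin d → ℂ := fun J j =>
    if j ∈ J then -(((w (i.succAbove j) : ℝ) : ℂ) * I) else ((w (i.succAbove j) : ℝ) : ℂ) * I
  have hJ : ∀ J : Finset (Fin d), SliceWindingEq G w i (qJ J) := by
    intro J
    induction J using Finset.induction_on with
    | empty => exact (hW i).of_slice_eq fun z => by simp [qJ]
    | insert j J hj ih =>
      have e : qJ (insert j J) = Function.update (qJ J) j (-qJ J j) := by
        funext k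
        by_cases hk : k = j
        · subst hk; simp [qJ, hj]
        · simp [qJ, hk]
      exact (ih.reflect j (hR (i.succAbove j))).of_slice_eq fun z => by rw [e]
  refine ⟨qJ (Finset.univ.filter fun j => s j = -1), fun j => ?_, hJ _⟩
  have hmem : (j ∈ Finset.univ.filter fun j => s j = -1) ↔ s j = -1 := by simp
  rcases hs j with e | e
  · have hn : ¬ s j = -1 := by rw [e]; norm_num
    have hq : qJ (Finset.univ.filter fun j => s j = -1) j = ((w (i.succAbove j) : ℝ) : ℂ) * I := by
      simp only [qJ]; rw [if_neg (hmem.not.mpr hn)]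
    rw [hq, e]; simp
  · have hq : qJ (Finset.univ.filter fun j => s j = -1) j = -(((w (i.succAbove j) : ℝ) : ℂ) * I) := by
      simp only [qJ]; rw [if_pos (hmem.mpr e)]
    rw [hq, e]; simp

/-- the equal-half-width reading (`w ≡ a`): four slices at the point `j ↦ i·a` give the (W) hypothesis of
`MatTubeHol.det_ne_zero_of_vertexTori` ∕ `CapRouteABoxes.rowsOfOneLoopFormCode16E_routeA₂_ofBoxesRealShift`. [folklore] -/
theorem windingHyp_of_reflect_const {a : ℝ} (hR : ∀ ν p, G (reflectAt ν p) = G p)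
    (hW : ∀ i : Fin (d + 1), SliceWindingEq G (fun _ => a) i fun _ => ((a : ℝ) : ℂ) * I) :
    ∀ (i : Fin (d + 1)) (s : Fin d → ℝ), (∀ j, s j = 1 ∨ s j = -1) →
      ∃ q₀ : Fin d → ℂ, (∀ j, (q₀ j).im = s j * a) ∧ SliceWindingEq G (fun _ => a) i q₀ :=
  windingHyp_of_reflect (w := fun _ => a) hR hW

end Winding

/-! ## §2 Determinant invariance under the four reflections from `q`-dependent conjugations (G6) -/

section Det

variable {n : Type*} [Fintype n] [DecidableEq n] {A : (Fin (d + 1) → ℂ) → Matrix n n ℂ}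

/-- four conjugation covariances `A (reflectAt ν q) = U_ν(q) A(q) V_ν(q)` with `V_ν U_ν = 1` ⟹ `det A` is invariant under every `reflectAt ν`. [folklore] -/
theorem det_reflectAt_of_matCovariantQ {U V : Fin (d + 1) → (Fin (d + 1) → ℂ) → Matrix n n ℂ}
    (hVU : ∀ ν q, V ν q * U ν q = 1) (hcov : ∀ ν, MatCovariantQ (reflectAt ν) (U ν) (V ν) A) :
    ∀ ν p, (A (reflectAt ν p)).det = (A p).det :=
  fun ν p => matCovariantQ_det_eq (hVU ν) (hcov ν) p

/-- **cap5's LITERAL FORM**: a character-sum stencil family `q ↦ Σ_{x ∈ S} e^{i x·q} K[x]` whose table satisfies the G6 ENTRY FORM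
`K (R_ν y + (dl j − dl i) e_ν) (perm i) (perm j) = s i · s j · K y i j` for EVERY direction `ν` (signs with `s i · s i = 1`) has a reflection-invariant
determinant: `det A (reflectAt ν p) = det A p`, `ν = 0, …, d`. [folklore] -/
theorem det_reflectAt_of_relabel (S : Finset (Fin (d + 1) → ℤ)) (K : (Fin (d + 1) → ℤ) → Matrix n n ℂ)
    (hK0 : ∀ x, x ∉ S → K x = 0) (perm : Fin (d + 1) → Equiv.Perm n) (s : Fin (d + 1) → n → ℂ) (dl : Fin (d + 1) → n → ℤ)
    (hs : ∀ ν i, s ν i * s ν i = 1)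
    (hK : ∀ ν y i j, K (shiftRefl ν (dl ν j - dl ν i) y) (perm ν i) (perm ν j) = s ν i * s ν j * K y i j) :
    ∀ ν p, (∑ x ∈ S, character x (reflectAt ν p) • K x).det = (∑ x ∈ S, character x p • K x).det :=
  det_reflectAt_of_matCovariantQ (A := fun q => ∑ x ∈ S, character x q • K x)
    (fun ν q => relabelConjInv_mul ν (perm ν) (s ν) (dl ν) (hs ν) q)
    fun ν => matCovariantQ_characterSum_relabel ν (perm ν) (s ν) (dl ν) S K hK0 (hK ν)

end Det

/-! ## §3 The anchor in certificate currency with (W) := four slices -/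

section Anchor

variable {b : ℕ → ℝ} {n : Type*} [Fintype n] [DecidableEq n]
variable {A B C D : (Fin 4 → ℂ) → Matrix n n ℂ} {κ Ba Sst Ss St : ℝ} {c : Fin 4 → ℂ}

/-- **ROUTE A'S ANCHOR IN CERTIFICATE CURRENCY, (W) AT FOUR SLICES.**  Exactly `CapRouteABoxes.rowsOfOneLoopFormCode16E_routeA₂_ofBoxesRealShift`
(data: (N) `hb`; STRUCTURE `MatTubeHol` ×5 at width `κ`, `MatNegTranspose A`, `MatConjSymm A`; ONE quarter-region box cover with per-leaf
`IsUnit (A q).det ∧ ‖(A q)⁻¹‖ ≤ Ba`; (Z2b) stencil sups; (T) `hT`; (A) `hA₀`; cmp `hlo`) with the (W) binder supplied as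
`hR` — `det A` invariant under the four coordinate reflections (for the cell: `det_reflectAt_of_relabel` from the G6 entry forms, cap5-g7) — and
`hW4` — `SliceWindingEq (det ∘ A)` at the FOUR all-plus slices `u ↦ det A (insertNth i (u ± iκ) (iκ, iκ, iκ))`, each from two closed compass
words (`TubeZeroFreeEnds.sliceWindingEq_of_words`): 8 words in all. [folklore] -/
def rowsOfOneLoopFormCode16E_routeA₂_ofBoxesRealShift_ofReflect
    (hb : b 0 = (latticeKernel (fun p => ((A p)⁻¹ * B p).trace - ((A p)⁻¹ * C p * (A (p - c))⁻¹ * D p).trace) 0).re)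
    (hκ : 0 < κ) (hc : ∀ μ, (c μ).im = 0)
    (hA : MatTubeHol A (fun _ => κ)) (hA' : MatTubeHol (fun p => A (p - c)) (fun _ => κ))
    (hBst : MatTubeHol B (fun _ => κ)) (hBs : MatTubeHol C (fun _ => κ)) (hBt : MatTubeHol D (fun _ => κ))
    (hAn : MatNegTranspose A) (hAc : MatConjSymm A)
    (ν₀ ν₁ : Fin (3 + 1)) {ι : Type*} (boxes : Finset ι) (ctr : ι → Fin (3 + 1) → ℂ) (hw : ι → Fin (3 + 1) → ℝ)
    (hcov : ∀ q ∈ VertexTori (fun _ : Fin (3 + 1) => κ), (q ν₀).im = κ → (q ν₁).re ≤ 0 → ∃ bx ∈ boxes, q ∈ Box (ctr bx) (hw bx))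
    (hcert : ∀ bx ∈ boxes, ∀ q ∈ Box (ctr bx) (hw bx), IsUnit (A q).det ∧ ‖(A q)⁻¹‖ ≤ Ba)
    (hR : ∀ (ν : Fin (3 + 1)) (p : Fin (3 + 1) → ℂ), (A (reflectAt ν p)).det = (A p).det)
    (hW4 : ∀ i : Fin (3 + 1), SliceWindingEq (fun p => (A p).det) (fun _ => κ) i fun _ => ((κ : ℝ) : ℂ) * I)
    (hSst : ∀ p ∈ VertexTori (fun _ : Fin (3 + 1) => κ), ‖B p‖ ≤ Sst)
    (hSs : ∀ p ∈ VertexTori (fun _ : Fin (3 + 1) => κ), ‖C p‖ ≤ Ss)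
    (hSt : ∀ p ∈ VertexTori (fun _ : Fin (3 + 1) => κ), ‖D p‖ ≤ St)
    {N : ℕ} (hN : 1 ≤ N) [NeZero (4 * N)] {t r : ℝ}
    (hT : ‖((code16SetE N).card : ℂ)⁻¹ *
        (∑ w ∈ code16SetE N, descend (fun p => ((A p)⁻¹ * B p).trace - ((A p)⁻¹ * C p * (A (p - c))⁻¹ * D p).trace)
          (gridPt (4 * N) w)) - t‖ ≤ r)
    {A₀ : ℝ} (hA₀ : Fintype.card n * (Ba * Sst + Ba * Ss * Ba * St) * codeTheta (aliasRatioL1 κ N) ≤ A₀) (lo : ℚ)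
    (hlo : ((lo : ℚ) : ℝ) ≤ t - r - A₀) : Rows b :=
  rowsOfOneLoopFormCode16E_routeA₂_ofBoxesRealShift hb hκ hc hA hA' hBst hBs hBt hAn hAc ν₀ ν₁ boxes ctr hw hcov hcert
    (windingHyp_of_reflect_const (G := fun p => (A p).det) hR hW4) hSst hSs hSt hN hT hA₀ lo hlo

/-- it IS gen 23's anchor at the derived (W) datum (definitional bookkeeping, for the cross-reader). [folklore] -/
theorem rowsOfOneLoopFormCode16E_routeA₂_ofBoxesRealShift_ofReflect_eq
    (hb : b 0 = (latticeKernel (fun p => ((A p)⁻¹ * B p).trace - ((A p)⁻¹ * C p * (A (p - c))⁻¹ * D p).trace) 0).re)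
    (hκ : 0 < κ) (hc : ∀ μ, (c μ).im = 0)
    (hA : MatTubeHol A (fun _ => κ)) (hA' : MatTubeHol (fun p => A (p - c)) (fun _ => κ))
    (hBst : MatTubeHol B (fun _ => κ)) (hBs : MatTubeHol C (fun _ => κ)) (hBt : MatTubeHol D (fun _ => κ))
    (hAn : MatNegTranspose A) (hAc : MatConjSymm A)
    (ν₀ ν₁ : Fin (3 + 1)) {ι : Type*} (boxes : Finset ι) (ctr : ι → Fin (3 + 1) → ℂ) (hw : ι → Fin (3 + 1) → ℝ)
    (hcov : ∀ q ∈ VertexTori (fun _ : Fin (3 + 1) => κ), (q ν₀).im = κ → (q ν₁).re ≤ 0 → ∃ bx ∈ boxes, q ∈ Box (ctr bx) (hw bx))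
    (hcert : ∀ bx ∈ boxes, ∀ q ∈ Box (ctr bx) (hw bx), IsUnit (A q).det ∧ ‖(A q)⁻¹‖ ≤ Ba)
    (hR : ∀ (ν : Fin (3 + 1)) (p : Fin (3 + 1) → ℂ), (A (reflectAt ν p)).det = (A p).det)
    (hW4 : ∀ i : Fin (3 + 1), SliceWindingEq (fun p => (A p).det) (fun _ => κ) i fun _ => ((κ : ℝ) : ℂ) * I)
    (hSst : ∀ p ∈ VertexTori (fun _ : Fin (3 + 1) => κ), ‖B p‖ ≤ Sst)
    (hSs : ∀ p ∈ VertexTori (fun _ : Fin (3 + 1) => κ), ‖C p‖ ≤ Ss)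
    (hSt : ∀ p ∈ VertexTori (fun _ : Fin (3 + 1) => κ), ‖D p‖ ≤ St)
    {N : ℕ} (hN : 1 ≤ N) [NeZero (4 * N)] {t r : ℝ}
    (hT : ‖((code16SetE N).card : ℂ)⁻¹ *
        (∑ w ∈ code16SetE N, descend (fun p => ((A p)⁻¹ * B p).trace - ((A p)⁻¹ * C p * (A (p - c))⁻¹ * D p).trace)
          (gridPt (4 * N) w)) - t‖ ≤ r)
    {A₀ : ℝ} (hA₀ : Fintype.card n * (Ba * Sst + Ba * Ss * Ba * St) * codeTheta (aliasRatioL1 κ N) ≤ A₀) (lo : ℚ)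
    (hlo : ((lo : ℚ) : ℝ) ≤ t - r - A₀) :
    rowsOfOneLoopFormCode16E_routeA₂_ofBoxesRealShift_ofReflect hb hκ hc hA hA' hBst hBs hBt hAn hAc ν₀ ν₁ boxes ctr hw hcov hcert
        hR hW4 hSst hSs hSt hN hT hA₀ lo hlo
      = rowsOfOneLoopFormCode16E_routeA₂_ofBoxesRealShift hb hκ hc hA hA' hBst hBs hBt hAn hAc ν₀ ν₁ boxes ctr hw hcov hcert
        (windingHyp_of_reflect_const (G := fun p => (A p).det) hR hW4) hSst hSs hSt hN hT hA₀ lo hlo := rfl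

end Anchor

/-! ## §4 The honest transport of a resolvent bound under a `q`-dependent conjugation (lossy) -/

section NormTransport

variable {n : Type*} [Fintype n] [DecidableEq n] {A : (Fin (d + 1) → ℂ) → Matrix n n ℂ}
variable {τ : (Fin (d + 1) → ℂ) → (Fin (d + 1) → ℂ)} {U V : (Fin (d + 1) → ℂ) → Matrix n n ℂ}

/-- **RESOLVENT NORM UNDER A CONJUGATION COVARIANCE** `A(τ q) = U(q) A(q) V(q)`, `V U = 1`: `‖A(τ q)⁻¹‖ ≤ ‖U q‖ · ‖A(q)⁻¹‖ · ‖V q‖` — EXACT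
transport only for unitary conjugators; for the G6 monomial conjugators at complex momenta the factor `‖U q‖‖V q‖` is `e^{|Im q_ν|·(max dl − min dl)}`. [folklore] -/
theorem invNorm_apply_le_of_matCovariantQ (hVU : ∀ q, V q * U q = 1) (hA : MatCovariantQ τ U V A) (q : Fin (d + 1) → ℂ) :
    ‖(A (τ q))⁻¹‖ ≤ ‖U q‖ * ‖(A q)⁻¹‖ * ‖V q‖ := by
  have e : (A (τ q))⁻¹ = U q * (A q)⁻¹ * V q := matCovariantQ_inv hVU hA q
  rw [e]
  exact (l2_opNorm_mul _ _).trans (mul_le_mul_of_nonneg_right (l2_opNorm_mul _ _) (norm_nonneg _))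

variable {w : Fin (d + 1) → ℝ}

/-- **ONE REFLECTION, WITH LOSS**: under `MatCovariantQ (reflectAt ν) U V A`, `V U = 1`, and `‖U q‖·‖V q‖ ≤ L` (`1 ≤ L`) on the vertex tori, a
resolvent bound `B` on the half `{Im q_ν = +w_ν}` of the vertex tori gives `L · B` on ALL of them.  (For the cell, `L = e^{κ}` per G6 reflection:
6.05× for the two-reflection reduction to 2 sign classes at `κ = 0.9` — recorded as UNECONOMIC at the N = 9 budget in the row's census.) [folklore] -/
theorem invNorm_le_vertexTori_of_plusHalf (ν : Fin (d + 1)) (hVU : ∀ q, V q * U q = 1) (hA : MatCovariantQ (reflectAt ν) U V A)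
    {L B : ℝ} (hL : ∀ q ∈ VertexTori w, ‖U q‖ * ‖V q‖ ≤ L) (h1 : 1 ≤ L)
    (hreg : ∀ q ∈ VertexTori w, (q ν).im = w ν → ‖(A q)⁻¹‖ ≤ B) :
    ∀ q ∈ VertexTori w, ‖(A q)⁻¹‖ ≤ L * B := by
  intro q hq
  have hB0 : 0 ≤ B := by
    -- the region is non-empty as soon as the vertex tori are: use the reflected or the original point
    by_cases h0 : (q ν).im = w ν
    · exact (norm_nonneg _).trans (hreg q hq h0)
    · have hq' := reflectAt_mem_vertexTori ν hq
      exact (norm_nonneg _).trans (hreg _ hq' (by rw [reflectAt_apply_same, neg_im, im_eq_neg_of_ne hq h0, neg_neg]))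
  by_cases h0 : (q ν).im = w ν
  · exact (hreg q hq h0).trans (le_mul_of_one_le_left hB0 h1)
  · have hq' : reflectAt ν q ∈ VertexTori w := reflectAt_mem_vertexTori ν hq
    have him : (reflectAt ν q ν).im = w ν := by rw [reflectAt_apply_same, neg_im, im_eq_neg_of_ne hq h0, neg_neg]
    have e : A q = A (reflectAt ν (reflectAt ν q)) := by rw [reflectAt_reflectAt]
    rw [e]
    calc ‖(A (reflectAt ν (reflectAt ν q)))⁻¹‖ ≤ ‖U (reflectAt ν q)‖ * ‖(A (reflectAt ν q))⁻¹‖ * ‖V (reflectAt ν q)‖ :=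
          invNorm_apply_le_of_matCovariantQ hVU hA _
      _ ≤ ‖U (reflectAt ν q)‖ * B * ‖V (reflectAt ν q)‖ := by gcongr; exact hreg _ hq' him
      _ = (‖U (reflectAt ν q)‖ * ‖V (reflectAt ν q)‖) * B := by ring
      _ ≤ L * B := mul_le_mul_of_nonneg_right (hL _ hq') hB0

end NormTransport

end

end Summit.QuantumFields.BalabanUV.Beta.CapRouteABoxesReflect
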